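import Summits.BirchSwinnertonDyer.BirchSwinnertonDyer.Theorems.TwoAdicConverseMultEisensteinPrint
import Summits.BirchSwinnertonDyer.BirchSwinnertonDyer.Theorems.ByReductionTypeAtTwoMultLowerHalfIso
import HarnessLib

/-!
# Route `TwoAdicConverse` (rung S3), multiplicative branch: the WALLS of the rank-`0` 2-converse
# (items stmt-BirchSwinnertonDyer-19219 `MultiplicativeRankZeroTwoConverse` / 19187 `MultTwoConverseOverKAtTwo`)
# and their EXACT position against the walls of the formula twin `MultLowerHalfAtTwo` (item 19923, rung K4)

Cell `bsd-2adic`, seat `bsd-2adic-conv-2` GEN 5 (2026-08-26). THEOREMS ONLY — nothing asserted, no definition, no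
named fact, no class booked; BSD is not proved by any of this. PARTITION (D-0054): none — RANK axis (S3 mult);
companion formula cell X5@2 mult (K4ᵐ, B1·O1; 1 976 book230 classes), whose lower half 19923 carries the LINE
`two_halves` (`Cruxes/MultLowerHalfAtTwo/Lines/two_halves.lean`).

WHAT THIS FILE DOES. The research stub of the LINE `cycint` under crux 19187 (GEN 4) asks the integral Eisenstein
direction of the `2`-adic main conjecture `X5.O1.MultEisensteinDivisibilityAtTwo` at SOME globally minimal member of
the isogeny class of EVERY non-CM curve multiplicative at `2` (rank-free, sign-free). The converse consumes it only
on the FINITE-`Sel_{2^∞}` locus (`multiplicativeRankZeroTwoConverse_of_multEisenstein_of_cotorsion_upToIsogeny`,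
GEN 4) and sign by sign (`multiplicativeRankZeroTwoConverse_iff_bySign`). The honest minimal research objects of the
S3ᵐ converse are therefore the two **S3ᵐ walls**

* WALL-S3-ns: for every non-CM globally minimal `W` NON-SPLIT multiplicative at `2` with `corank_{ℤ₂} Sel_{2^∞}(W/ℚ) = 0`,
  SOME `ℚ`-isogenous globally minimal `W'` multiplicative at `2` satisfies `X5.O1.MultEisensteinDivisibilityAtTwo W'`;
* WALL-S3-sp: the same for SPLIT multiplicative reduction at `2`,

while the registered walls of `two_halves` (K4ᵐ, item 19923) — **WALL-K4-ns / WALL-K4-sp** — are the same sentences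
with «`corank Sel_{2^∞} = 0`» replaced by «analytic rank `0`». This file proves, by name and sorry-free:

§1 the converse from the S3ᵐ walls: WALL-S3-ns + PRINT {A235-twin, modularity, Greenberg Thm. 1.5} ⟹ the NON-SPLIT
   half of 19219 (NO memo binder); WALL-S3-sp + PRINT {A236, modularity, Thm. 1.5} + MEMO {Greenberg–Stevens at a
   split `2`} ⟹ the SPLIT half; both ⟹ `MultiplicativeRankZeroTwoConverse` (19219) and, with the route's PUB child
   `MultConversePublishedInputsAtTwo` (19185), the SERVED crux `MultTwoConverseOverKAtTwo` (19187) — the composition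
   of a reshaped LINE `cycint` (v2) whose research stubs are the two S3ᵐ walls;
§2 **the two cells' walls differ by EXACTLY the converse**: WALL-S3-ε ⟹ WALL-K4-ε modulo `MultConversePublishedInputsAtTwo`
   (Kato Cor. 14.3 at `2` + entire continuation: analytic rank `0` ⟹ `L(E,1) ≠ 0` ⟹ `Sel_{2^∞}` finite), and
   WALL-K4-ε ∧ (ε-half of 19219) ⟹ WALL-S3-ε (pure logic); hence WALL-S3-ε ⟺ WALL-K4-ε ∧ (ε-half of 19219) modulo
   PRINT (+ GS at a split `2` for ε = split), and **modulo the K4ᵐ walls the S3ᵐ converse is EQUIVALENT to the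
   S3ᵐ walls** (`multiplicativeRankZeroTwoConverse_iff_wallsS3_of_wallsK4`);
§3 one research object for both lines: the S3ᵐ walls close the K4ᵐ item `MultLowerHalfAtTwo` (19923) as well
   (`multLowerHalfAtTwo_of_wallsS3`, via mult-3 GEN 5's `multLowerHalfAtTwo_of_multEisensteinIso_bySign`), and the
   GEN-4 stub `stub_multEisensteinIso` implies both S3ᵐ walls (`wallsS3_of_multEisensteinIso`).
So a disprover seated against a K4ᵐ wall kills the S3ᵐ wall of the same sign, a proof of an S3ᵐ wall closes the
research stub of BOTH lines for that sign, and what separates the two cells' research objects is precisely the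
rank-`0` 2-converse itself. Not in print at `p = 2` (Skinner 2016 Thm. A/B `p ≥ 3`; Skinner–Urban 2014 `p` odd;
Burungale–Tian 2026 p. 3 names the direction); no claim of progress on the walls themselves.

Sources read (held): Greenberg, LNM 1716 (1999) §1 pp. 54–61, §4 pp. 112–113; Kato, Astérisque 295 (2004) Cor. 14.3
(p. 235); Mazur–Tate–Teitelbaum, Invent. math. 84 (1986) §I.14, §II.10; the cell's audit sheets D-AUDIT-h15 /
K11a-locator (HOME/audit/).
-/

set_option linter.dupNamespace false
set_option autoImplicit false

noncomputable section

open scoped Classical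

open WeierstrassCurve Literature.NumberTheory.EllipticCurves
  Literature.NumberTheory.EllipticCurves.ModularForms
  Literature.NumberTheory.EllipticCurves.Greenberg1999
  Literature.NumberTheory.EllipticCurves.Rank1Residual
  Literature.NumberTheory.EllipticCurves.Rank1Residual.Typed
  Summit.BirchSwinnertonDyer.Rank1Residual.X5
  Summit.BirchSwinnertonDyer.Rank1Residual.X5.O1
  Summit.BirchSwinnertonDyer.BirchSwinnertonDyer.Theses.TwoAdicConverse

namespace Summit.BirchSwinnertonDyer.BirchSwinnertonDyer.Theorems

namespace MultWalls

/-! ## §0 From analytic rank `0` to corank `0` (Kato Cor. 14.3 at `2`, PRINT) -/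

/-- **Analytic rank `0` ⟹ `corank_{ℤ₂} Sel_{2^∞}(E/ℚ) = 0`**, from the route's PUB child
`MultConversePublishedInputsAtTwo` (item 19185): entire continuation turns `ord_{s=1} L(E,s) = 0` into `L(E,1) ≠ 0`
(`analyticRank_eq_zero_iff_L_one_ne_zero_of_hasEntireLFunction_rat`), and Kato's Cor. 14.3 at `p = 2` makes
`Sel_{2^∞}(E/ℚ)` finite, i.e. of corank `0`. This is the one-way bridge from the K4ᵐ locus (analytic rank `0`)
to the S3ᵐ locus (finite `Sel`). [cite: Kato2004Asterisque, Cor. 14.3 (p. 235)] [cite: BCDTJAMS2001, Thm. A] -/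
theorem selmerCorank_two_eq_zero_of_analyticRank_eq_zero (hP : MultConversePublishedInputsAtTwo)
    (W : WeierstrassCurve ℚ) [W.IsElliptic] (hr : W.analyticRank = 0) : W.selmerCorank 2 = 0 := by
  have hL : W.entireLFunction 1 ≠ 0 :=
    (analyticRank_eq_zero_iff_L_one_ne_zero_of_hasEntireLFunction_rat hP.2 W).mp hr
  obtain ⟨-, -, hfin⟩ := hP.1 W hL
  haveI := hfin
  exact W.selmerCorank_eq_zero_of_finite 2

/-! ## §1 The converse from the S3ᵐ walls (composition of LINE `cycint` v2) -/

/-- **NON-SPLIT half of the crux from WALL-S3-ns + PRINT, no memo binder.** PRINT {A235-twin `h41ns`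
(Greenberg's non-split display, guarded form), modularity `hmod`, Greenberg Thm. 1.5 `h15`} and WALL-S3-ns
(`hWns`: T-mult-4-int at SOME isogenous globally minimal multiplicative member, asked only for non-CM `W`
non-split multiplicative at `2` with `corank Sel_{2^∞}(W/ℚ) = 0`) ⟹ for every such `W`: `r_an(W) = 0`.
Proof: corank and analytic rank are isogeny invariants (`analyticRank_eq_zero_of_isIsogenous_of_selmerCorank_two_eq_zero`),
non-split multiplicative reduction at `2` passes to `W'` (`a₂` is an isogeny invariant), and at `W'` GEN 4's
per-curve theorem `analyticRank_eq_zero_of_selmerCorank_eq_zero_nonsplit_two_of_multEisenstein_print` applies.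
[cite: GreenbergLNM1716, §4 pp. 112–113 and Thm. 1.5 (p. 61)] [cite: MazurTateTeitelbaum1986Invent, §I.14] -/
theorem nonsplitMultRankZeroTwoConverse_of_wallS3
    (h41ns : thm41Analogue_charValue_rankZero_numberField_anyPrime_oddLocalDegree)
    (hmod : nonempty_modularParametrizationData) (h15 : thm15_isTorsion_multiplicative_rat)
    (hWns : ∀ (W : WeierstrassCurve ℚ) [W.IsElliptic] [W.IsGloballyMinimal], ¬ W.HasCM → Mult W 2 →
      ¬ W.HasSplitMultiplicativeReductionAtPrime 2 → W.selmerCorank 2 = 0 →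
        ∃ (W' : WeierstrassCurve ℚ) (_ : W'.IsElliptic) (_ : W'.IsGloballyMinimal),
          IsIsogenous W W' ∧ Mult W' 2 ∧ MultEisensteinDivisibilityAtTwo W') :
    ∀ (W : WeierstrassCurve ℚ) [W.IsElliptic] [W.IsGloballyMinimal], ¬ W.HasCM → Mult W 2 →
      ¬ W.HasSplitMultiplicativeReductionAtPrime 2 → W.selmerCorank 2 = 0 → W.analyticRank = 0 := by
  intro W _ _ hcm hmult hns hsel
  obtain ⟨W', _, _, hiso, hmult', hE'⟩ := hWns W hcm hmult hns hsel
  refine analyticRank_eq_zero_of_isIsogenous_of_selmerCorank_two_eq_zero hiso (fun hsel' ↦ ?_) hsel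
  have hns' : ¬ W'.HasSplitMultiplicativeReductionAtPrime 2 :=
    fun h ↦ hns ((hasSplitMultiplicativeReductionAtPrime_two_iff_of_isIsogenous hiso).mpr h)
  exact (analyticRank_eq_zero_of_selmerCorank_eq_zero_nonsplit_two_of_multEisenstein_print W' h41ns hmod h15
    hE' hmult' hns' hsel').2

/-- **SPLIT half of the crux from WALL-S3-sp + PRINT + Greenberg–Stevens at a split `2`.** PRINT {A236 `h41sp`
(Greenberg's split base-change display), modularity `hmod`, Greenberg Thm. 1.5 `h15`} + MEMO {`hGS`:
Greenberg–Stevens at a split multiplicative `2` (cell memo PROOF-GS2, referee RC-4 PASS; print keeps `p` odd)} and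
WALL-S3-sp (`hWsp`) ⟹ for every non-CM `W` SPLIT multiplicative at `2`: `corank Sel_{2^∞} = 0 ⇒ r_an(W) = 0`.
Same transport as the non-split half; at `W'` GEN 0's per-curve theorem
`analyticRank_eq_zero_of_finite_selmer_split_two_of_multEisenstein` with the torsion binder from Thm. 1.5.
[cite: GreenbergLNM1716, §4 pp. 112–113 and Thm. 1.5 (p. 61)] [cite: MazurTateTeitelbaum1986Invent, §II.10] -/
theorem splitMultRankZeroTwoConverse_of_wallS3
    (h41sp : thm41Analogue_charValue_rankZero_split_baseChange_anyPrime)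
    (hmod : nonempty_modularParametrizationData) (h15 : thm15_isTorsion_multiplicative_rat)
    (hGS : ∀ (W : WeierstrassCurve ℚ) [W.IsElliptic] [W.IsGloballyMinimal],
      W.HasSplitMultiplicativeReductionAtPrime 2 → greenberg_stevens (W := W) (p := 2))
    (hWsp : ∀ (W : WeierstrassCurve ℚ) [W.IsElliptic] [W.IsGloballyMinimal], ¬ W.HasCM → Mult W 2 →
      W.HasSplitMultiplicativeReductionAtPrime 2 → W.selmerCorank 2 = 0 →
        ∃ (W' : WeierstrassCurve ℚ) (_ : W'.IsElliptic) (_ : W'.IsGloballyMinimal),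
          IsIsogenous W W' ∧ Mult W' 2 ∧ MultEisensteinDivisibilityAtTwo W') :
    ∀ (W : WeierstrassCurve ℚ) [W.IsElliptic] [W.IsGloballyMinimal], ¬ W.HasCM → Mult W 2 →
      W.HasSplitMultiplicativeReductionAtPrime 2 → W.selmerCorank 2 = 0 → W.analyticRank = 0 := by
  intro W _ _ hcm hmult hsp hsel
  haveI : Fact (Nat.Prime 2) := ⟨Nat.prime_two⟩
  obtain ⟨W', _, _, hiso, hmult', hE'⟩ := hWsp W hcm hmult hsp hsel
  refine analyticRank_eq_zero_of_isIsogenous_of_selmerCorank_two_eq_zero hiso (fun hsel' ↦ ?_) hsel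
  have hsp' : W'.HasSplitMultiplicativeReductionAtPrime 2 :=
    (hasSplitMultiplicativeReductionAtPrime_two_iff_of_isIsogenous hiso).mp hsp
  have hfin' : Finite (W'.selmerGroupPInfty 2) :=
    (finite_selmerGroupPInfty_iff_selmerCorank_eq_zero W' 2).mpr hsel'
  exact (analyticRank_eq_zero_of_finite_selmer_split_two_of_multEisenstein W' (hGS W' hsp') h41sp hmod
    (isTorsion_two_of_thm15 W' h15 hmod hmult') hE' hmult' hsp' hfin').2

/-- **The crux `MultiplicativeRankZeroTwoConverse` (item 19219) from the two S3ᵐ walls.** PRINT {A235-twin,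
A236, modularity, Greenberg Thm. 1.5} + MEMO {Greenberg–Stevens at a split `2`, split wall only} + WALL-S3-ns +
WALL-S3-sp ⟹ 19219, by `multiplicativeRankZeroTwoConverse_iff_bySign`. The walls are the WEAKEST objects any
cyclotomic-integral road of the cell consumes: finite-`Sel` locus only, sign by sign, up to isogeny.
[cite: GreenbergLNM1716, §4 pp. 112–113 and Thm. 1.5 (p. 61)] [cite: MazurTateTeitelbaum1986Invent, §I.14 and §II.10] -/
theorem multiplicativeRankZeroTwoConverse_of_wallsS3
    (h41ns : thm41Analogue_charValue_rankZero_numberField_anyPrime_oddLocalDegree)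
    (h41sp : thm41Analogue_charValue_rankZero_split_baseChange_anyPrime)
    (hmod : nonempty_modularParametrizationData) (h15 : thm15_isTorsion_multiplicative_rat)
    (hGS : ∀ (W : WeierstrassCurve ℚ) [W.IsElliptic] [W.IsGloballyMinimal],
      W.HasSplitMultiplicativeReductionAtPrime 2 → greenberg_stevens (W := W) (p := 2))
    (hWns : ∀ (W : WeierstrassCurve ℚ) [W.IsElliptic] [W.IsGloballyMinimal], ¬ W.HasCM → Mult W 2 →
      ¬ W.HasSplitMultiplicativeReductionAtPrime 2 → W.selmerCorank 2 = 0 →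
        ∃ (W' : WeierstrassCurve ℚ) (_ : W'.IsElliptic) (_ : W'.IsGloballyMinimal),
          IsIsogenous W W' ∧ Mult W' 2 ∧ MultEisensteinDivisibilityAtTwo W')
    (hWsp : ∀ (W : WeierstrassCurve ℚ) [W.IsElliptic] [W.IsGloballyMinimal], ¬ W.HasCM → Mult W 2 →
      W.HasSplitMultiplicativeReductionAtPrime 2 → W.selmerCorank 2 = 0 →
        ∃ (W' : WeierstrassCurve ℚ) (_ : W'.IsElliptic) (_ : W'.IsGloballyMinimal),
          IsIsogenous W W' ∧ Mult W' 2 ∧ MultEisensteinDivisibilityAtTwo W') :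
    MultiplicativeRankZeroTwoConverse :=
  multiplicativeRankZeroTwoConverse_iff_bySign.mpr
    ⟨nonsplitMultRankZeroTwoConverse_of_wallS3 h41ns hmod h15 hWns,
      splitMultRankZeroTwoConverse_of_wallS3 h41sp hmod h15 hGS hWsp⟩

/-- **The SERVED crux `MultTwoConverseOverKAtTwo` (item 19187) from the two S3ᵐ walls** — the composition of the
reshaped LINE `cycint` (v2): the route's PUB child `MultConversePublishedInputsAtTwo` (`hP`, item 19185) + PRINT
{A235-twin, A236, modularity, Thm. 1.5} + MEMO {Greenberg–Stevens at a split `2`} + WALL-S3-ns + WALL-S3-sp ⟹ 19187,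
through `19219 ⟹ 19187` modulo PUB (`multTwoConverseOverKAtTwo_of_multiplicativeRankZeroTwoConverse`, p418586).
[cite: GreenbergLNM1716, §4 pp. 112–113 and Thm. 1.5 (p. 61)] [cite: Kato2004Asterisque, Cor. 14.3 (p. 235)] -/
theorem multTwoConverseOverKAtTwo_of_wallsS3 (hP : MultConversePublishedInputsAtTwo)
    (h41ns : thm41Analogue_charValue_rankZero_numberField_anyPrime_oddLocalDegree)
    (h41sp : thm41Analogue_charValue_rankZero_split_baseChange_anyPrime)
    (hmod : nonempty_modularParametrizationData) (h15 : thm15_isTorsion_multiplicative_rat)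
    (hGS : ∀ (W : WeierstrassCurve ℚ) [W.IsElliptic] [W.IsGloballyMinimal],
      W.HasSplitMultiplicativeReductionAtPrime 2 → greenberg_stevens (W := W) (p := 2))
    (hWns : ∀ (W : WeierstrassCurve ℚ) [W.IsElliptic] [W.IsGloballyMinimal], ¬ W.HasCM → Mult W 2 →
      ¬ W.HasSplitMultiplicativeReductionAtPrime 2 → W.selmerCorank 2 = 0 →
        ∃ (W' : WeierstrassCurve ℚ) (_ : W'.IsElliptic) (_ : W'.IsGloballyMinimal),
          IsIsogenous W W' ∧ Mult W' 2 ∧ MultEisensteinDivisibilityAtTwo W')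
    (hWsp : ∀ (W : WeierstrassCurve ℚ) [W.IsElliptic] [W.IsGloballyMinimal], ¬ W.HasCM → Mult W 2 →
      W.HasSplitMultiplicativeReductionAtPrime 2 → W.selmerCorank 2 = 0 →
        ∃ (W' : WeierstrassCurve ℚ) (_ : W'.IsElliptic) (_ : W'.IsGloballyMinimal),
          IsIsogenous W W' ∧ Mult W' 2 ∧ MultEisensteinDivisibilityAtTwo W') :
    MultTwoConverseOverKAtTwo :=
  multTwoConverseOverKAtTwo_of_multiplicativeRankZeroTwoConverse hP
    (multiplicativeRankZeroTwoConverse_of_wallsS3 h41ns h41sp hmod h15 hGS hWns hWsp)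

/-- **cycint v1 ⟹ cycint v2 (bookkeeping).** The GEN-4 research stub `stub_multEisensteinIso` (rank-free, sign-free:
T-mult-4-int at SOME isogenous minimal multiplicative member for EVERY non-CM `W` multiplicative at `2`) implies both
S3ᵐ walls (drop the sign and the finite-`Sel` hypotheses). [folklore] -/
theorem wallsS3_of_multEisensteinIso
    (hEiso : ∀ (W : WeierstrassCurve ℚ) [W.IsElliptic] [W.IsGloballyMinimal], ¬ W.HasCM → Mult W 2 →
      ∃ (W' : WeierstrassCurve ℚ) (_ : W'.IsElliptic) (_ : W'.IsGloballyMinimal),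
        IsIsogenous W W' ∧ Mult W' 2 ∧ MultEisensteinDivisibilityAtTwo W') :
    (∀ (W : WeierstrassCurve ℚ) [W.IsElliptic] [W.IsGloballyMinimal], ¬ W.HasCM → Mult W 2 →
      ¬ W.HasSplitMultiplicativeReductionAtPrime 2 → W.selmerCorank 2 = 0 →
        ∃ (W' : WeierstrassCurve ℚ) (_ : W'.IsElliptic) (_ : W'.IsGloballyMinimal),
          IsIsogenous W W' ∧ Mult W' 2 ∧ MultEisensteinDivisibilityAtTwo W') ∧
    (∀ (W : WeierstrassCurve ℚ) [W.IsElliptic] [W.IsGloballyMinimal], ¬ W.HasCM → Mult W 2 →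
      W.HasSplitMultiplicativeReductionAtPrime 2 → W.selmerCorank 2 = 0 →
        ∃ (W' : WeierstrassCurve ℚ) (_ : W'.IsElliptic) (_ : W'.IsGloballyMinimal),
          IsIsogenous W W' ∧ Mult W' 2 ∧ MultEisensteinDivisibilityAtTwo W') :=
  ⟨fun W _ _ hcm hmult _ _ ↦ hEiso W hcm hmult, fun W _ _ hcm hmult _ _ ↦ hEiso W hcm hmult⟩

/-! ## §2 The S3ᵐ walls against the K4ᵐ walls: they differ by exactly the converse -/

/-- **WALL-S3-ns ⟹ WALL-K4-ns modulo PUB.** Given the route's PUB child `MultConversePublishedInputsAtTwo` (`hP`,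
item 19185: Kato Cor. 14.3 at `2` + entire continuation), the S3ᵐ non-split wall (asked on the finite-`Sel` locus)
implies the registered non-split WALL of LINE `two_halves` of item 19923 (asked on the analytic-rank-`0` locus):
analytic rank `0` ⟹ corank `0` (§0). [cite: Kato2004Asterisque, Cor. 14.3 (p. 235)] [cite: BCDTJAMS2001, Thm. A] -/
theorem wallK4_nonsplit_of_wallS3 (hP : MultConversePublishedInputsAtTwo)
    (hWns : ∀ (W : WeierstrassCurve ℚ) [W.IsElliptic] [W.IsGloballyMinimal], ¬ W.HasCM → Mult W 2 →
      ¬ W.HasSplitMultiplicativeReductionAtPrime 2 → W.selmerCorank 2 = 0 →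
        ∃ (W' : WeierstrassCurve ℚ) (_ : W'.IsElliptic) (_ : W'.IsGloballyMinimal),
          IsIsogenous W W' ∧ Mult W' 2 ∧ MultEisensteinDivisibilityAtTwo W') :
    ∀ (W : WeierstrassCurve ℚ) [W.IsElliptic] [W.IsGloballyMinimal], ¬ W.HasCM →
      W.analyticRank = 0 → Mult W 2 → ¬ W.HasSplitMultiplicativeReductionAtPrime 2 →
        ∃ (W' : WeierstrassCurve ℚ) (_ : W'.IsElliptic) (_ : W'.IsGloballyMinimal),
          IsIsogenous W W' ∧ Mult W' 2 ∧ MultEisensteinDivisibilityAtTwo W' :=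
  fun W _ _ hcm hr hmult hns ↦
    hWns W hcm hmult hns (selmerCorank_two_eq_zero_of_analyticRank_eq_zero hP W hr)

/-- **WALL-S3-sp ⟹ WALL-K4-sp modulo PUB** (split twin of `wallK4_nonsplit_of_wallS3`).
[cite: Kato2004Asterisque, Cor. 14.3 (p. 235)] [cite: BCDTJAMS2001, Thm. A] -/
theorem wallK4_split_of_wallS3 (hP : MultConversePublishedInputsAtTwo)
    (hWsp : ∀ (W : WeierstrassCurve ℚ) [W.IsElliptic] [W.IsGloballyMinimal], ¬ W.HasCM → Mult W 2 →
      W.HasSplitMultiplicativeReductionAtPrime 2 → W.selmerCorank 2 = 0 →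
        ∃ (W' : WeierstrassCurve ℚ) (_ : W'.IsElliptic) (_ : W'.IsGloballyMinimal),
          IsIsogenous W W' ∧ Mult W' 2 ∧ MultEisensteinDivisibilityAtTwo W') :
    ∀ (W : WeierstrassCurve ℚ) [W.IsElliptic] [W.IsGloballyMinimal], ¬ W.HasCM →
      W.analyticRank = 0 → Mult W 2 → W.HasSplitMultiplicativeReductionAtPrime 2 →
        ∃ (W' : WeierstrassCurve ℚ) (_ : W'.IsElliptic) (_ : W'.IsGloballyMinimal),
          IsIsogenous W W' ∧ Mult W' 2 ∧ MultEisensteinDivisibilityAtTwo W' :=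
  fun W _ _ hcm hr hmult hsp ↦
    hWsp W hcm hmult hsp (selmerCorank_two_eq_zero_of_analyticRank_eq_zero hP W hr)

/-- **WALL-K4-ns ∧ (non-split half of 19219) ⟹ WALL-S3-ns** (pure logic: the converse moves a finite-`Sel` curve onto
the analytic-rank-`0` locus, where the K4ᵐ wall speaks). [folklore] -/
theorem wallS3_nonsplit_of_wallK4_of_converse
    (hK4ns : ∀ (W : WeierstrassCurve ℚ) [W.IsElliptic] [W.IsGloballyMinimal], ¬ W.HasCM →
      W.analyticRank = 0 → Mult W 2 → ¬ W.HasSplitMultiplicativeReductionAtPrime 2 →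
        ∃ (W' : WeierstrassCurve ℚ) (_ : W'.IsElliptic) (_ : W'.IsGloballyMinimal),
          IsIsogenous W W' ∧ Mult W' 2 ∧ MultEisensteinDivisibilityAtTwo W')
    (hconv : ∀ (W : WeierstrassCurve ℚ) [W.IsElliptic] [W.IsGloballyMinimal], ¬ W.HasCM → Mult W 2 →
      ¬ W.HasSplitMultiplicativeReductionAtPrime 2 → W.selmerCorank 2 = 0 → W.analyticRank = 0) :
    ∀ (W : WeierstrassCurve ℚ) [W.IsElliptic] [W.IsGloballyMinimal], ¬ W.HasCM → Mult W 2 →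
      ¬ W.HasSplitMultiplicativeReductionAtPrime 2 → W.selmerCorank 2 = 0 →
        ∃ (W' : WeierstrassCurve ℚ) (_ : W'.IsElliptic) (_ : W'.IsGloballyMinimal),
          IsIsogenous W W' ∧ Mult W' 2 ∧ MultEisensteinDivisibilityAtTwo W' :=
  fun W _ _ hcm hmult hns hsel ↦ hK4ns W hcm (hconv W hcm hmult hns hsel) hmult hns

/-- **WALL-K4-sp ∧ (split half of 19219) ⟹ WALL-S3-sp** (split twin of `wallS3_nonsplit_of_wallK4_of_converse`). [folklore] -/
theorem wallS3_split_of_wallK4_of_converse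
    (hK4sp : ∀ (W : WeierstrassCurve ℚ) [W.IsElliptic] [W.IsGloballyMinimal], ¬ W.HasCM →
      W.analyticRank = 0 → Mult W 2 → W.HasSplitMultiplicativeReductionAtPrime 2 →
        ∃ (W' : WeierstrassCurve ℚ) (_ : W'.IsElliptic) (_ : W'.IsGloballyMinimal),
          IsIsogenous W W' ∧ Mult W' 2 ∧ MultEisensteinDivisibilityAtTwo W')
    (hconv : ∀ (W : WeierstrassCurve ℚ) [W.IsElliptic] [W.IsGloballyMinimal], ¬ W.HasCM → Mult W 2 →
      W.HasSplitMultiplicativeReductionAtPrime 2 → W.selmerCorank 2 = 0 → W.analyticRank = 0) :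
    ∀ (W : WeierstrassCurve ℚ) [W.IsElliptic] [W.IsGloballyMinimal], ¬ W.HasCM → Mult W 2 →
      W.HasSplitMultiplicativeReductionAtPrime 2 → W.selmerCorank 2 = 0 →
        ∃ (W' : WeierstrassCurve ℚ) (_ : W'.IsElliptic) (_ : W'.IsGloballyMinimal),
          IsIsogenous W W' ∧ Mult W' 2 ∧ MultEisensteinDivisibilityAtTwo W' :=
  fun W _ _ hcm hmult hsp hsel ↦ hK4sp W hcm (hconv W hcm hmult hsp hsel) hmult hsp

/-- **WALL-S3-ns ⟺ WALL-K4-ns ∧ (non-split half of 19219), modulo PRINT only.** Binders: the route's PUB child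
`MultConversePublishedInputsAtTwo` (`hP`), A235-twin `h41ns`, modularity `hmod`, Greenberg Thm. 1.5 `h15` — all PRINT,
no memo. The EXACT position of the S3ᵐ non-split research object: one rank-`0` 2-converse above the registered K4ᵐ
non-split WALL of item 19923. [cite: GreenbergLNM1716, §4 pp. 112–113 and Thm. 1.5 (p. 61)]
[cite: Kato2004Asterisque, Cor. 14.3 (p. 235)] -/
theorem wallS3_nonsplit_iff_wallK4_and_converse (hP : MultConversePublishedInputsAtTwo)
    (h41ns : thm41Analogue_charValue_rankZero_numberField_anyPrime_oddLocalDegree)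
    (hmod : nonempty_modularParametrizationData) (h15 : thm15_isTorsion_multiplicative_rat) :
    (∀ (W : WeierstrassCurve ℚ) [W.IsElliptic] [W.IsGloballyMinimal], ¬ W.HasCM → Mult W 2 →
      ¬ W.HasSplitMultiplicativeReductionAtPrime 2 → W.selmerCorank 2 = 0 →
        ∃ (W' : WeierstrassCurve ℚ) (_ : W'.IsElliptic) (_ : W'.IsGloballyMinimal),
          IsIsogenous W W' ∧ Mult W' 2 ∧ MultEisensteinDivisibilityAtTwo W') ↔
    ((∀ (W : WeierstrassCurve ℚ) [W.IsElliptic] [W.IsGloballyMinimal], ¬ W.HasCM →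
        W.analyticRank = 0 → Mult W 2 → ¬ W.HasSplitMultiplicativeReductionAtPrime 2 →
          ∃ (W' : WeierstrassCurve ℚ) (_ : W'.IsElliptic) (_ : W'.IsGloballyMinimal),
            IsIsogenous W W' ∧ Mult W' 2 ∧ MultEisensteinDivisibilityAtTwo W') ∧
      (∀ (W : WeierstrassCurve ℚ) [W.IsElliptic] [W.IsGloballyMinimal], ¬ W.HasCM → Mult W 2 →
        ¬ W.HasSplitMultiplicativeReductionAtPrime 2 → W.selmerCorank 2 = 0 → W.analyticRank = 0)) :=
  ⟨fun hWns ↦ ⟨wallK4_nonsplit_of_wallS3 hP hWns, nonsplitMultRankZeroTwoConverse_of_wallS3 h41ns hmod h15 hWns⟩,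
    fun h ↦ wallS3_nonsplit_of_wallK4_of_converse h.1 h.2⟩

/-- **WALL-S3-sp ⟺ WALL-K4-sp ∧ (split half of 19219), modulo PRINT + Greenberg–Stevens at a split `2`.** Binders:
`hP`, A236 `h41sp`, modularity, Thm. 1.5 (PRINT) and `hGS` (MEMO PROOF-GS2, split case).
[cite: GreenbergLNM1716, §4 pp. 112–113 and Thm. 1.5 (p. 61)] [cite: Kato2004Asterisque, Cor. 14.3 (p. 235)] -/
theorem wallS3_split_iff_wallK4_and_converse (hP : MultConversePublishedInputsAtTwo)
    (h41sp : thm41Analogue_charValue_rankZero_split_baseChange_anyPrime)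
    (hmod : nonempty_modularParametrizationData) (h15 : thm15_isTorsion_multiplicative_rat)
    (hGS : ∀ (W : WeierstrassCurve ℚ) [W.IsElliptic] [W.IsGloballyMinimal],
      W.HasSplitMultiplicativeReductionAtPrime 2 → greenberg_stevens (W := W) (p := 2)) :
    (∀ (W : WeierstrassCurve ℚ) [W.IsElliptic] [W.IsGloballyMinimal], ¬ W.HasCM → Mult W 2 →
      W.HasSplitMultiplicativeReductionAtPrime 2 → W.selmerCorank 2 = 0 →
        ∃ (W' : WeierstrassCurve ℚ) (_ : W'.IsElliptic) (_ : W'.IsGloballyMinimal),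
          IsIsogenous W W' ∧ Mult W' 2 ∧ MultEisensteinDivisibilityAtTwo W') ↔
    ((∀ (W : WeierstrassCurve ℚ) [W.IsElliptic] [W.IsGloballyMinimal], ¬ W.HasCM →
        W.analyticRank = 0 → Mult W 2 → W.HasSplitMultiplicativeReductionAtPrime 2 →
          ∃ (W' : WeierstrassCurve ℚ) (_ : W'.IsElliptic) (_ : W'.IsGloballyMinimal),
            IsIsogenous W W' ∧ Mult W' 2 ∧ MultEisensteinDivisibilityAtTwo W') ∧
      (∀ (W : WeierstrassCurve ℚ) [W.IsElliptic] [W.IsGloballyMinimal], ¬ W.HasCM → Mult W 2 →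
        W.HasSplitMultiplicativeReductionAtPrime 2 → W.selmerCorank 2 = 0 → W.analyticRank = 0)) :=
  ⟨fun hWsp ↦ ⟨wallK4_split_of_wallS3 hP hWsp, splitMultRankZeroTwoConverse_of_wallS3 h41sp hmod h15 hGS hWsp⟩,
    fun h ↦ wallS3_split_of_wallK4_of_converse h.1 h.2⟩

/-- **Modulo the K4ᵐ walls, the S3ᵐ converse IS the pair of S3ᵐ walls.** Granted PRINT {A235-twin, A236,
modularity, Thm. 1.5} + MEMO {GS at a split `2`} and the two registered WALLS of LINE `two_halves` of item 19923
(`hK4ns`, `hK4sp`): `MultiplicativeRankZeroTwoConverse ↔ WALL-S3-ns ∧ WALL-S3-sp` (the direction `→` is pure logic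
and needs no binder; `←` is §1). So what separates the research objects of the two cells (K4ᵐ lower half vs S3ᵐ
converse) is precisely the rank-`0` 2-converse, and nothing else.
[cite: GreenbergLNM1716, §4 pp. 112–113 and Thm. 1.5 (p. 61)] [cite: Kato2004Asterisque, Cor. 14.3 (p. 235)] -/
theorem multiplicativeRankZeroTwoConverse_iff_wallsS3_of_wallsK4
    (h41ns : thm41Analogue_charValue_rankZero_numberField_anyPrime_oddLocalDegree)
    (h41sp : thm41Analogue_charValue_rankZero_split_baseChange_anyPrime)
    (hmod : nonempty_modularParametrizationData) (h15 : thm15_isTorsion_multiplicative_rat)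
    (hGS : ∀ (W : WeierstrassCurve ℚ) [W.IsElliptic] [W.IsGloballyMinimal],
      W.HasSplitMultiplicativeReductionAtPrime 2 → greenberg_stevens (W := W) (p := 2))
    (hK4ns : ∀ (W : WeierstrassCurve ℚ) [W.IsElliptic] [W.IsGloballyMinimal], ¬ W.HasCM →
      W.analyticRank = 0 → Mult W 2 → ¬ W.HasSplitMultiplicativeReductionAtPrime 2 →
        ∃ (W' : WeierstrassCurve ℚ) (_ : W'.IsElliptic) (_ : W'.IsGloballyMinimal),
          IsIsogenous W W' ∧ Mult W' 2 ∧ MultEisensteinDivisibilityAtTwo W')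
    (hK4sp : ∀ (W : WeierstrassCurve ℚ) [W.IsElliptic] [W.IsGloballyMinimal], ¬ W.HasCM →
      W.analyticRank = 0 → Mult W 2 → W.HasSplitMultiplicativeReductionAtPrime 2 →
        ∃ (W' : WeierstrassCurve ℚ) (_ : W'.IsElliptic) (_ : W'.IsGloballyMinimal),
          IsIsogenous W W' ∧ Mult W' 2 ∧ MultEisensteinDivisibilityAtTwo W') :
    MultiplicativeRankZeroTwoConverse ↔
      ((∀ (W : WeierstrassCurve ℚ) [W.IsElliptic] [W.IsGloballyMinimal], ¬ W.HasCM → Mult W 2 →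
          ¬ W.HasSplitMultiplicativeReductionAtPrime 2 → W.selmerCorank 2 = 0 →
            ∃ (W' : WeierstrassCurve ℚ) (_ : W'.IsElliptic) (_ : W'.IsGloballyMinimal),
              IsIsogenous W W' ∧ Mult W' 2 ∧ MultEisensteinDivisibilityAtTwo W') ∧
        (∀ (W : WeierstrassCurve ℚ) [W.IsElliptic] [W.IsGloballyMinimal], ¬ W.HasCM → Mult W 2 →
          W.HasSplitMultiplicativeReductionAtPrime 2 → W.selmerCorank 2 = 0 →
            ∃ (W' : WeierstrassCurve ℚ) (_ : W'.IsElliptic) (_ : W'.IsGloballyMinimal),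
              IsIsogenous W W' ∧ Mult W' 2 ∧ MultEisensteinDivisibilityAtTwo W')) := by
  constructor
  · intro h
    obtain ⟨hns, hsp⟩ := multiplicativeRankZeroTwoConverse_iff_bySign.mp h
    exact ⟨wallS3_nonsplit_of_wallK4_of_converse hK4ns hns, wallS3_split_of_wallK4_of_converse hK4sp hsp⟩
  · rintro ⟨hWns, hWsp⟩
    exact multiplicativeRankZeroTwoConverse_of_wallsS3 h41ns h41sp hmod h15 hGS hWns hWsp

/-! ## §3 One research object for both lines: the S3ᵐ walls also close K4ᵐ's `MultLowerHalfAtTwo` (item 19923) -/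

/-- **The S3ᵐ walls close the K4ᵐ lower half too.** PRINT ×7 {the route's PUB child `hP` (Kato Cor. 14.3 at `2` ∧
entire continuation), A235-twin, A236, modularity, Gross–Zagier–Kolyvagin `hGZK`, Greenberg Thm. 1.5, Cassels'
isogeny invariance `hCassels`} + MEMO {GS at a split `2`} + WALL-S3-ns + WALL-S3-sp ⟹ `MultLowerHalfAtTwo` (item
19923 of route `ByReductionTypeAtTwo`): §2 turns the S3ᵐ walls into the `two_halves` walls and mult-3 GEN 5's
`multLowerHalfAtTwo_of_multEisensteinIso_bySign` composes. So a proof of the two S3ᵐ walls closes the research stubs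
of BOTH registered lines (`cycint` on 19187, `two_halves` on 19923). [cite: GreenbergLNM1716, Thm. 1.5 (p. 61) and §4 pp. 112–113]
[cite: Cassels1965ArithmeticVIII, Thm. 1.1] [cite: Kato2004Asterisque, Cor. 14.3 (p. 235)] -/
theorem multLowerHalfAtTwo_of_wallsS3 (hP : MultConversePublishedInputsAtTwo)
    (h41ns : thm41Analogue_charValue_rankZero_numberField_anyPrime_oddLocalDegree)
    (h41sp : thm41Analogue_charValue_rankZero_split_baseChange_anyPrime)
    (hmod : nonempty_modularParametrizationData) (hGZK : rank_eq_analyticRank_of_analyticRank_le_one)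
    (h15 : thm15_isTorsion_multiplicative_rat) (hCassels : bsdRHS_eq_of_isIsogenous)
    (hGS : ∀ (W : WeierstrassCurve ℚ) [W.IsElliptic] [W.IsGloballyMinimal],
      W.HasSplitMultiplicativeReductionAtPrime 2 → greenberg_stevens (W := W) (p := 2))
    (hWns : ∀ (W : WeierstrassCurve ℚ) [W.IsElliptic] [W.IsGloballyMinimal], ¬ W.HasCM → Mult W 2 →
      ¬ W.HasSplitMultiplicativeReductionAtPrime 2 → W.selmerCorank 2 = 0 →
        ∃ (W' : WeierstrassCurve ℚ) (_ : W'.IsElliptic) (_ : W'.IsGloballyMinimal),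
          IsIsogenous W W' ∧ Mult W' 2 ∧ MultEisensteinDivisibilityAtTwo W')
    (hWsp : ∀ (W : WeierstrassCurve ℚ) [W.IsElliptic] [W.IsGloballyMinimal], ¬ W.HasCM → Mult W 2 →
      W.HasSplitMultiplicativeReductionAtPrime 2 → W.selmerCorank 2 = 0 →
        ∃ (W' : WeierstrassCurve ℚ) (_ : W'.IsElliptic) (_ : W'.IsGloballyMinimal),
          IsIsogenous W W' ∧ Mult W' 2 ∧ MultEisensteinDivisibilityAtTwo W') :
    Summit.BirchSwinnertonDyer.BirchSwinnertonDyer.Theses.ByReductionTypeAtTwo.MultLowerHalfAtTwo :=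
  multLowerHalfAtTwo_of_multEisensteinIso_bySign h41ns h41sp hmod hGZK h15 hCassels hGS
    (wallK4_nonsplit_of_wallS3 hP hWns) (wallK4_split_of_wallS3 hP hWsp)

end MultWalls

end Summit.BirchSwinnertonDyer.BirchSwinnertonDyer.Theorems

end
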